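import Summits.QuantumFields.YangMills.Theorems.VirialFluxGapCentralZeroModeField
import Summits.QuantumFields.YangMills.Theorems.VirialFluxGapCombConstantDeficit
import HarnessLib

/-!
# Route `VirialFluxGap` (YangMills): the zero-mode field of an ARBITRARY LINK BLOCK — coefficients, own-curve derivatives, exact divergence;
# the WRAP-LAYER blocks of the tree-gauged host `X_fix`

Brick (C1) of the central charts for ⟨stmt-QuantumFields-24141⟩ ON `X_fix` (referee ruling 2026-08-30T23:30Z: at a central toron the 12 zero
modes of the tree-gauged Hessian are the BLOCK-UNIFORM frame directions on the three WRAP LAYERS `x_k = −1` (all slices) and on the seam;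
`P_z` = block averaging).  ✓`VirialFluxGapCentralZeroModeField` did this for the full direction blocks of `Ω_L`; here the slice block is an
arbitrary finite set `S` of (slice, site) pairs for the direction `k` — so both hosts are instances — and §5 specialises to the wrap layers:

* §1 `bsliceCoeff σ S k a P = ½σ·⟨Im_a q⟩_S` (average over the links `(i,(x,k))`, `(i,x) ∈ S`), a continuous linear functional of the
  coordinates (`exists_bsliceCoeff_clm`);
* §2 ★★ `hasDerivAt_bsliceCoeff` — along the frame curve of a block variable `(i,x) ∈ S` in the unit direction `u_a` the coefficient has the
  derivative `bsliceDeriv σ S k a i x = ½σ·Im_a(q·u_a)/|S|` at every parameter (the block sum of the tangent family collapses to the moving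
  variable, `sum_imEntry_sliceTangent_block`); regularity `bslice_regular`;
* §3 ★★ `block_div_eq` ∕ `block_div_le` — `Σ_{v∈S}Σ_a bsliceDeriv = (3/2)σ·⟨Re q⟩_S ≤ 3/2` for `|σ| ≤ 1` (✓`sum_im_mul_zUnit`), and with the
  seam block ★★★ `blockZeroModeField_div_le` — `div X_z ≤ 6 = 12 × ½` for ANY three non-empty slice blocks and the seam, everywhere;
* §4 the WRAP blocks `wrapBlock k = {(i,x) : x_k = −1}`: `card_wrapBlock = (2L−1+1)·L²` (✓`CombConstant.card_filter_apply_eq`), non-empty, and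
  ★ `bsliceCoeff_wrapBlock_combConst` — on a comb-constant history (every slice `combFlat h`, seam `q`) the wrap-block coefficient is the common
  value `½σ·Im_a(su2Quat h_k)` (so on the central family the field IS the radial flow of ✓`CombConstantRadialFlow`).

HONEST FRAMING: the zero-mode HALF of the central-chart field on the `X_fix` host; its transverse (resolvent) half, the chart inequalities and
the patching are NOT here; ⟨24141⟩ stays OPEN; the Yang–Mills mass gap is NOT proved; no summit is proved by a line.  Three plumbing `def`s
(`bsliceCoeff`, `bsliceDeriv`, `wrapBlock`; no `Prop`), theorems otherwise; 0 `sorry`, standard axioms.  Width seat `ym-line-sfw-p2-w3` g58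
(cell ym-idea-1, free hands), `--supports stmt-QuantumFields-24141`.
References: [cite: arXiv220412737, §2 (2.4) (p. 10)]; [cite: CosteEtAl1985]; [cite: Luscher1983, §2]; [cite: SeilerLNP1982, §2].
-/

set_option autoImplicit false

noncomputable section

open scoped Matrix BigOperators ContDiff Topology Quaternion
open MeasureTheory
open Literature.MathematicalPhysics.QuantumFieldTheory hiding SU2
open Literature.MathematicalPhysics.QuantumLattice
open Literature.MathematicalPhysics.QuantumFieldTheory.SUNBakryEmery (expSU matTop)

namespace Summit.QuantumFields.YangMills.Theorems.VirialFluxGap.FrameDerivative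

open Summit.QuantumFields.YangMills.Theorems.FemtoTransferGap
open Summit.QuantumFields.YangMills.Theorems.FemtoTransferGap.TwoLattice.Flat (combFlat combFlat_apply)
open Summit.QuantumFields.YangMills.Theorems.VirialFluxGap.CombConstant (card_filter_apply_eq)

variable {L : ℕ} [NeZero L]

open scoped Matrix.Norms.Frobenius

attribute [local instance 2000] Literature.MathematicalPhysics.QuantumFieldTheory.SUNBakryEmery.matTop

/-! ## §1 The block-averaged signed coefficients of an arbitrary link block -/

/-- The zero-mode coefficient of the link block `S` (pairs (slice, site); direction `k`) in the frame direction `a`, with sign `σ`: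
`½·σ·⟨Im_a q⟩_S`. [cite: CosteEtAl1985] -/
def bsliceCoeff (L : ℕ) [NeZero L] (σ : ℝ) (S : Finset (Fin (2 * L - 1 + 1) × Site 3 L)) (k a : Fin 3)
    (P : (Fin (2 * L - 1 + 1) → GaugeConfig 3 L SU2) × (Site 3 L → SU2)) : ℝ :=
  (1 / 2 : ℝ) * σ * ((∑ v ∈ S, (![(su2Quat (P.1 v.1 (v.2, k))).imI, (su2Quat (P.1 v.1 (v.2, k))).imJ,
    (su2Quat (P.1 v.1 (v.2, k))).imK] : Fin 3 → ℝ) a) / (S.card : ℝ))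

/-- The derivative of the block coefficient along the frame curve of the block variable `(i,(x,k))` in the direction `u_a`:
`½σ·Im_a(q·u_a)/|S|`. [folklore] -/
def bsliceDeriv (L : ℕ) [NeZero L] (σ : ℝ) (S : Finset (Fin (2 * L - 1 + 1) × Site 3 L)) (k a : Fin 3) (i : Fin (2 * L - 1 + 1))
    (x : Site 3 L) (P : (Fin (2 * L - 1 + 1) → GaugeConfig 3 L SU2) × (Site 3 L → SU2)) : ℝ :=
  (1 / 2 : ℝ) * σ * ((![(su2Quat (P.1 i (x, k)) * zUnit a).imI, (su2Quat (P.1 i (x, k)) * zUnit a).imJ,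
    (su2Quat (P.1 i (x, k)) * zUnit a).imK] : Fin 3 → ℝ) a / (S.card : ℝ))

/-- The block coefficient factors through the coordinates as a continuous linear functional. [folklore] -/
theorem exists_bsliceCoeff_clm (σ : ℝ) (S : Finset (Fin (2 * L - 1 + 1) × Site 3 L)) (k a : Fin 3) :
    ∃ ℓ : ((Fin (2 * L - 1 + 1) → Edge 3 L → Matrix (Fin 2) (Fin 2) ℂ) × (Site 3 L → Matrix (Fin 2) (Fin 2) ℂ)) →L[ℝ] ℝ,
      (∀ M, ℓ M = (1 / 2 : ℝ) * σ * ((∑ v ∈ S,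
        (![((M.1 v.1 (v.2, k)) 0 0).im, ((M.1 v.1 (v.2, k)) 0 1).re, ((M.1 v.1 (v.2, k)) 0 1).im] : Fin 3 → ℝ) a) / (S.card : ℝ))) ∧
      ∀ P, bsliceCoeff L σ S k a P = ℓ (ringCoord L P) := by
  refine ⟨LinearMap.toContinuousLinearMap
      { toFun := fun M => (1 / 2 : ℝ) * σ * ((∑ v ∈ S,
          (![((M.1 v.1 (v.2, k)) 0 0).im, ((M.1 v.1 (v.2, k)) 0 1).re, ((M.1 v.1 (v.2, k)) 0 1).im] : Fin 3 → ℝ) a) / (S.card : ℝ)),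
        map_add' := fun M N => by
          fin_cases a <;> simp [Finset.sum_add_distrib] <;> ring,
        map_smul' := fun c M => by
          fin_cases a <;> simp <;> simp only [← Finset.mul_sum] <;> ring },
    fun M => rfl, fun P => ?_⟩
  fin_cases a <;> rfl

/-! ## §2 Own-curve derivatives of the block coefficients -/

omit [NeZero L] in
/-- The block sum of first-row entries of a slice tangent family collapses to the moving variable (when it belongs to the block). [folklore] -/
theorem sum_imEntry_sliceTangent_block {S : Finset (Fin (2 * L - 1 + 1) × Site 3 L)} {i : Fin (2 * L - 1 + 1)} {x : Site 3 L}
    (hS : (i, x) ∈ S) (k a : Fin 3) (Y : Matrix (Fin 2) (Fin 2) ℂ) (P : (Fin (2 * L - 1 + 1) → GaugeConfig 3 L SU2) × (Site 3 L → SU2)) :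
    (∑ v ∈ S, (![(((sliceTangent i (x, k) Y P).1 v.1 (v.2, k)) 0 0).im, (((sliceTangent i (x, k) Y P).1 v.1 (v.2, k)) 0 1).re,
        (((sliceTangent i (x, k) Y P).1 v.1 (v.2, k)) 0 1).im] : Fin 3 → ℝ) a) =
      (![(((P.1 i (x, k) : Matrix (Fin 2) (Fin 2) ℂ) * Y) 0 0).im, (((P.1 i (x, k) : Matrix (Fin 2) (Fin 2) ℂ) * Y) 0 1).re,
        (((P.1 i (x, k) : Matrix (Fin 2) (Fin 2) ℂ) * Y) 0 1).im] : Fin 3 → ℝ) a := by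
  have hzero : ∀ v : Fin (2 * L - 1 + 1) × Site 3 L, v ≠ (i, x) →
      (![(((sliceTangent i (x, k) Y P).1 v.1 (v.2, k)) 0 0).im, (((sliceTangent i (x, k) Y P).1 v.1 (v.2, k)) 0 1).re,
        (((sliceTangent i (x, k) Y P).1 v.1 (v.2, k)) 0 1).im] : Fin 3 → ℝ) a = 0 := by
    intro v hv
    have hne : ¬(v.1 = i ∧ ((v.2, k) : Edge 3 L) = (x, k)) := fun h' => hv (Prod.ext h'.1 (Prod.mk.inj h'.2).1)
    have ht : (sliceTangent i (x, k) Y P).1 v.1 (v.2, k) = 0 := by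
      simp only [sliceTangent, sliceDir_of_ne Y hne, Matrix.mul_zero]
    rw [ht]
    fin_cases a <;> simp
  have hself : (sliceTangent i (x, k) Y P).1 i (x, k) = (P.1 i (x, k) : Matrix (Fin 2) (Fin 2) ℂ) * Y := by
    simp only [sliceTangent, sliceDir_self]
  rw [Finset.sum_eq_single_of_mem (i, x) hS (fun v _ hv => hzero v hv)]
  dsimp only
  rw [hself]

/-- ★★ **Own-curve derivative of the block coefficient**: along `sliceCurve i (x,k) (quatMatrix (zUnit a))` of a block variable `(i,x) ∈ S`
the coefficient `bsliceCoeff σ S k a` has derivative `bsliceDeriv σ S k a i x` at the moving point, at EVERY parameter.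
[cite: arXiv220412737, §2 (2.4) (p. 10)] -/
theorem hasDerivAt_bsliceCoeff (σ : ℝ) {S : Finset (Fin (2 * L - 1 + 1) × Site 3 L)} (k a : Fin 3) {i : Fin (2 * L - 1 + 1)} {x : Site 3 L}
    (hS : (i, x) ∈ S) (P : (Fin (2 * L - 1 + 1) → GaugeConfig 3 L SU2) × (Site 3 L → SU2)) (t : ℝ) :
    HasDerivAt (fun s => bsliceCoeff L σ S k a (P * sliceCurve i (x, k) (quatMatrix_zUnit_conjTranspose a) (quatMatrix_zUnit_trace a) s))
      (bsliceDeriv L σ S k a i x (P * sliceCurve i (x, k) (quatMatrix_zUnit_conjTranspose a) (quatMatrix_zUnit_trace a) t)) t := by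
  obtain ⟨ℓ, hℓ, hφ⟩ := exists_bsliceCoeff_clm (L := L) σ S k a
  have heq : (fun s => bsliceCoeff L σ S k a (P * sliceCurve i (x, k) (quatMatrix_zUnit_conjTranspose a) (quatMatrix_zUnit_trace a) s)) =
      fun s => ℓ (ringCoord L (P * sliceCurve i (x, k) (quatMatrix_zUnit_conjTranspose a) (quatMatrix_zUnit_trace a) s)) :=
    funext fun s => hφ _
  rw [heq]
  have h := hasDerivAt_comp_ringCoord_sliceCurve (L := L) ℓ.contDiff i (x, k) (quatMatrix_zUnit_conjTranspose a) (quatMatrix_zUnit_trace a) P t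
  refine h.congr_deriv ?_
  rw [ℓ.fderiv, hℓ, sum_imEntry_sliceTangent_block hS, imEntry_coe_mul_quatMatrix, bsliceDeriv]

/-- The block derivative factors through the coordinates by a continuous function. [folklore] -/
theorem bsliceDeriv_eq_comp (σ : ℝ) (S : Finset (Fin (2 * L - 1 + 1) × Site 3 L)) (k a : Fin 3) (i : Fin (2 * L - 1 + 1)) (x : Site 3 L)
    (P : (Fin (2 * L - 1 + 1) → GaugeConfig 3 L SU2) × (Site 3 L → SU2)) :
    bsliceDeriv L σ S k a i x P =
      (fun M : (Fin (2 * L - 1 + 1) → Edge 3 L → Matrix (Fin 2) (Fin 2) ℂ) × (Site 3 L → Matrix (Fin 2) (Fin 2) ℂ) =>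
        (1 / 2 : ℝ) * σ * ((![((M.1 i (x, k) * quatMatrix (zUnit a)) 0 0).im, ((M.1 i (x, k) * quatMatrix (zUnit a)) 0 1).re,
          ((M.1 i (x, k) * quatMatrix (zUnit a)) 0 1).im] : Fin 3 → ℝ) a / (S.card : ℝ)))
        (ringCoord L P) := by
  simp only [bsliceDeriv, ringCoord]
  rw [imEntry_coe_mul_quatMatrix]

/-- ★ **Regularity of the block coefficient and of its own-curve derivative** (measurable ∕ bounded ∕ continuous ∕ strongly measurable —
the `hφm`, `hφb`, `hDφb`, `hDφm` clauses of the Euler-field hypothesis for this part of the field). [folklore] -/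
theorem bslice_regular (σ : ℝ) (S : Finset (Fin (2 * L - 1 + 1) × Site 3 L)) (k a : Fin 3) (i : Fin (2 * L - 1 + 1)) (x : Site 3 L) :
    (Measurable (bsliceCoeff L σ S k a) ∧ ∃ B : ℝ, ∀ P, |bsliceCoeff L σ S k a P| ≤ B) ∧
    (Continuous (bsliceDeriv L σ S k a i x) ∧ (∃ B : ℝ, ∀ P, |bsliceDeriv L σ S k a i x P| ≤ B) ∧
      StronglyMeasurable (bsliceDeriv L σ S k a i x)) := by
  obtain ⟨ℓ, -, hφ⟩ := exists_bsliceCoeff_clm (L := L) σ S k a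
  have hco : bsliceCoeff L σ S k a = fun P => ℓ (ringCoord L P) := funext hφ
  have r1 := regular_comp_ringCoord (L := L) ℓ.continuous
  have hg : Continuous fun M : (Fin (2 * L - 1 + 1) → Edge 3 L → Matrix (Fin 2) (Fin 2) ℂ) × (Site 3 L → Matrix (Fin 2) (Fin 2) ℂ) =>
      (1 / 2 : ℝ) * σ * ((![((M.1 i (x, k) * quatMatrix (zUnit a)) 0 0).im, ((M.1 i (x, k) * quatMatrix (zUnit a)) 0 1).re,
        ((M.1 i (x, k) * quatMatrix (zUnit a)) 0 1).im] : Fin 3 → ℝ) a / (S.card : ℝ)) := by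
    have hm : ContDiff ℝ ∞ fun M : (Fin (2 * L - 1 + 1) → Edge 3 L → Matrix (Fin 2) (Fin 2) ℂ) × (Site 3 L → Matrix (Fin 2) (Fin 2) ℂ) =>
        M.1 i (x, k) * quatMatrix (zUnit a) := (contDiff_coord_fst i (x, k)).mul contDiff_const
    exact (contDiff_const.mul (((contDiff_imEntry a).comp hm).div_const _)).continuous
  have r2 := regular_comp_ringCoord (L := L) hg
  have hde : bsliceDeriv L σ S k a i x = fun P => (fun M : (Fin (2 * L - 1 + 1) → Edge 3 L → Matrix (Fin 2) (Fin 2) ℂ) ×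
      (Site 3 L → Matrix (Fin 2) (Fin 2) ℂ) =>
        (1 / 2 : ℝ) * σ * ((![((M.1 i (x, k) * quatMatrix (zUnit a)) 0 0).im, ((M.1 i (x, k) * quatMatrix (zUnit a)) 0 1).re,
          ((M.1 i (x, k) * quatMatrix (zUnit a)) 0 1).im] : Fin 3 → ℝ) a / (S.card : ℝ))) (ringCoord L P) :=
    funext fun P => bsliceDeriv_eq_comp σ S k a i x P
  refine ⟨⟨?_, ?_⟩, ?_, ?_, ?_⟩
  · rw [hco]; exact r1.2.2.measurable
  · rw [hco]; exact r1.2.1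
  · rw [hde]; exact r2.1
  · rw [hde]; exact r2.2.1
  · rw [hde]; exact r2.2.2

/-! ## §3 The exact divergence of a block field, and of the whole zero-mode field -/

/-- ★★ **The divergence of one block, exactly**: `Σ_{(i,x)∈S} Σ_a bsliceDeriv σ S k a i x P = (3/2)·σ·⟨Re q⟩_S`. [cite: CosteEtAl1985] -/
theorem block_div_eq (σ : ℝ) (S : Finset (Fin (2 * L - 1 + 1) × Site 3 L)) (k : Fin 3)
    (P : (Fin (2 * L - 1 + 1) → GaugeConfig 3 L SU2) × (Site 3 L → SU2)) :
    ∑ v ∈ S, ∑ a : Fin 3, bsliceDeriv L σ S k a v.1 v.2 P =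
      (3 / 2 : ℝ) * σ * ((∑ v ∈ S, (su2Quat (P.1 v.1 (v.2, k))).re) / (S.card : ℝ)) := by
  have hv : ∀ v : Fin (2 * L - 1 + 1) × Site 3 L,
      ∑ a : Fin 3, bsliceDeriv L σ S k a v.1 v.2 P = (3 / 2 : ℝ) * σ * (su2Quat (P.1 v.1 (v.2, k))).re / (S.card : ℝ) := by
    intro v
    have h := sum_im_mul_zUnit (su2Quat (P.1 v.1 (v.2, k)))
    simp only [bsliceDeriv]
    rw [← Finset.mul_sum, ← Finset.sum_div, h]
    ring
  simp only [hv]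
  rw [Finset.sum_div, Finset.mul_sum]
  refine Finset.sum_congr rfl fun v _ => ?_
  ring

/-- ★★ **One block contributes at most `3/2`** to the divergence, for `|σ| ≤ 1` (any block, empty included). [cite: CosteEtAl1985] -/
theorem block_div_le {σ : ℝ} (hσ : |σ| ≤ 1) (S : Finset (Fin (2 * L - 1 + 1) × Site 3 L)) (k : Fin 3)
    (P : (Fin (2 * L - 1 + 1) → GaugeConfig 3 L SU2) × (Site 3 L → SU2)) :
    ∑ v ∈ S, ∑ a : Fin 3, bsliceDeriv L σ S k a v.1 v.2 P ≤ 3 / 2 := by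
  rw [block_div_eq]
  rcases S.eq_empty_or_nonempty with hS | hS
  · subst hS; norm_num
  have hc : (0 : ℝ) < (S.card : ℝ) := by exact_mod_cast hS.card_pos
  have h1 : σ * (∑ v ∈ S, (su2Quat (P.1 v.1 (v.2, k))).re) ≤ (S.card : ℝ) := by
    rw [Finset.mul_sum]
    calc ∑ v ∈ S, σ * (su2Quat (P.1 v.1 (v.2, k))).re ≤ ∑ v ∈ S, (1 : ℝ) :=
          Finset.sum_le_sum fun v _ => (le_abs_self _).trans (abs_sigma_mul_re_le hσ _)
      _ = (S.card : ℝ) := by simp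
  have h2 : σ * ((∑ v ∈ S, (su2Quat (P.1 v.1 (v.2, k))).re) / (S.card : ℝ)) ≤ 1 := by
    rw [← mul_div_assoc, div_le_iff₀ hc]; linarith
  nlinarith

/-- The seam block contributes at most `3/2` to the divergence, for `|σ₄| ≤ 1` (✓`zseamDeriv` of the `Ω_L` file; the seam block is the
same on both hosts). [cite: CosteEtAl1985] -/
theorem seam_div_le {σ₄ : ℝ} (hσ₄ : |σ₄| ≤ 1) (P : (Fin (2 * L - 1 + 1) → GaugeConfig 3 L SU2) × (Site 3 L → SU2)) :
    ∑ x : Site 3 L, ∑ a : Fin 3, zseamDeriv L σ₄ a x P ≤ 3 / 2 := by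
  have hL : (0 : ℝ) < (L : ℝ) := by exact_mod_cast NeZero.pos L
  have hL3 : (0 : ℝ) < (L : ℝ) ^ 3 := by positivity
  have hsite : (Fintype.card (Site 3 L) : ℝ) = (L : ℝ) ^ 3 := by
    rw [TwoLattice.Electric.card_site]; push_cast; ring
  have hseam : ∀ x : Site 3 L, ∑ a : Fin 3, zseamDeriv L σ₄ a x P = (3 / 2 : ℝ) * σ₄ * (su2Quat (P.2 x)).re / ((L : ℝ) ^ 3) := by
    intro x
    have h := sum_im_mul_zUnit (su2Quat (P.2 x))
    simp only [zseamDeriv]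
    rw [← Finset.mul_sum, ← Finset.sum_div, h]
    ring
  simp only [hseam]
  rw [← Finset.sum_div]
  have h2 : ∑ x : Site 3 L, (3 / 2 : ℝ) * σ₄ * (su2Quat (P.2 x)).re ≤ (3 / 2 : ℝ) * (L : ℝ) ^ 3 := by
    calc ∑ x : Site 3 L, (3 / 2 : ℝ) * σ₄ * (su2Quat (P.2 x)).re ≤ ∑ x : Site 3 L, (3 / 2 : ℝ) := by
          refine Finset.sum_le_sum fun x _ => ?_
          have h := (le_abs_self _).trans (abs_sigma_mul_re_le hσ₄ (P.2 x))
          nlinarith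
      _ = (3 / 2 : ℝ) * (L : ℝ) ^ 3 := by
          simp only [Finset.sum_const, Finset.card_univ, nsmul_eq_mul, hsite]; ring
  rw [div_le_iff₀ hL3]
  exact h2

/-- ★★★ **The divergence of the block zero-mode field is at most `6 = 12 × ½`** everywhere, for ANY three slice blocks `S_k` (signs
`|σ_k| ≤ 1`) and the seam block (`|σ₄| ≤ 1`) — in particular for the wrap-layer blocks of the `X_fix` host. [cite: CosteEtAl1985] -/
theorem blockZeroModeField_div_le {σ : Fin 3 → ℝ} {σ₄ : ℝ} (hσ : ∀ k, |σ k| ≤ 1) (hσ₄ : |σ₄| ≤ 1)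
    (S : Fin 3 → Finset (Fin (2 * L - 1 + 1) × Site 3 L)) (P : (Fin (2 * L - 1 + 1) → GaugeConfig 3 L SU2) × (Site 3 L → SU2)) :
    (∑ k : Fin 3, ∑ v ∈ S k, ∑ a : Fin 3, bsliceDeriv L (σ k) (S k) k a v.1 v.2 P) +
      ∑ x : Site 3 L, ∑ a : Fin 3, zseamDeriv L σ₄ a x P ≤ 6 := by
  have h1 : ∑ k : Fin 3, ∑ v ∈ S k, ∑ a : Fin 3, bsliceDeriv L (σ k) (S k) k a v.1 v.2 P ≤ ∑ k : Fin 3, (3 / 2 : ℝ) :=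
    Finset.sum_le_sum fun k _ => block_div_le (hσ k) (S k) k P
  have h3 : ∑ k : Fin 3, (3 / 2 : ℝ) = 9 / 2 := by
    simp only [Finset.sum_const, Finset.card_univ, Fintype.card_fin, nsmul_eq_mul]; norm_num
  have h2 := seam_div_le hσ₄ P
  linarith

/-! ## §4 The wrap-layer blocks of the tree-gauged host -/

/-- The WRAP BLOCK of direction `k`: all (slice, site) pairs with the site on the wrap layer `x_k = −1` — the links of direction `k` that carry
the holonomy representative `h_k` of a comb-flat configuration (✓`combFlat`). [cite: SeilerLNP1982, §2] -/
def wrapBlock (L : ℕ) [NeZero L] (k : Fin 3) : Finset (Fin (2 * L - 1 + 1) × Site 3 L) :=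
  Finset.univ ×ˢ (Finset.univ.filter fun x : Site 3 L => x k = -1)

/-- Membership in the wrap block. [folklore] -/
theorem mem_wrapBlock (k : Fin 3) (v : Fin (2 * L - 1 + 1) × Site 3 L) : v ∈ wrapBlock L k ↔ v.2 k = -1 := by
  simp [wrapBlock]

/-- ★ The wrap block has `(2L−1+1)·L²` elements. [cite: SeilerLNP1982, §2] -/
theorem card_wrapBlock (k : Fin 3) : (wrapBlock L k).card = (2 * L - 1 + 1) * L ^ 2 := by
  rw [wrapBlock, Finset.card_product, Finset.card_univ, Fintype.card_fin, card_filter_apply_eq k (-1)]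

/-- The wrap block is non-empty. [folklore] -/
theorem wrapBlock_nonempty (k : Fin 3) : (wrapBlock L k).Nonempty := by
  rw [← Finset.card_pos, card_wrapBlock]
  have hL : 0 < L := NeZero.pos L
  positivity

/-- ★ **On a comb-constant history the wrap-block coefficient is the common value**: every wrap link of direction `k` carries `h_k`, so
`bsliceCoeff σ (wrapBlock k) k a (combConst h q) = ½σ·Im_a(su2Quat h_k)`. [cite: Luscher1983, §2] -/
theorem bsliceCoeff_wrapBlock_combConst (σ : ℝ) (k a : Fin 3) (h : Fin 3 → SU2) (q : SU2) :
    bsliceCoeff L σ (wrapBlock L k) k a ((fun _ : Fin (2 * L - 1 + 1) => combFlat (L := L) h, fun _ : Site 3 L => q) :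
        (Fin (2 * L - 1 + 1) → GaugeConfig 3 L SU2) × (Site 3 L → SU2)) =
      (1 / 2 : ℝ) * σ * (![(su2Quat (h k)).imI, (su2Quat (h k)).imJ, (su2Quat (h k)).imK] : Fin 3 → ℝ) a := by
  unfold bsliceCoeff
  have hc : (0 : ℝ) < ((wrapBlock L k).card : ℝ) := by exact_mod_cast (wrapBlock_nonempty (L := L) k).card_pos
  have hsum : (∑ v ∈ wrapBlock L k, (![(su2Quat (combFlat (L := L) h (v.2, k))).imI, (su2Quat (combFlat (L := L) h (v.2, k))).imJ,
      (su2Quat (combFlat (L := L) h (v.2, k))).imK] : Fin 3 → ℝ) a) =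
      ∑ v ∈ wrapBlock L k, (![(su2Quat (h k)).imI, (su2Quat (h k)).imJ, (su2Quat (h k)).imK] : Fin 3 → ℝ) a := by
    refine Finset.sum_congr rfl fun v hv => ?_
    rw [mem_wrapBlock] at hv
    rw [combFlat_apply, if_pos hv]
  dsimp only
  rw [hsum, Finset.sum_const, nsmul_eq_mul]
  field_simp

end Summit.QuantumFields.YangMills.Theorems.VirialFluxGap.FrameDerivative

end
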